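import Summits.QuantumFields.BalabanUV.T4Continuum.Support.NE7PairResidualSupRep
import HarnessLib

/-!
# NE7PairResidualSupRepLog — THE PAIR RESIDUAL SUP-REPRESENTATIVE IN CHART FORM (F325, d = 4, L = 2): the four non-slice members of row NE3's
# `ResidualSliceRepT` at an arbitrary small-field pair with equal top averages — a unitary `(N·M)`-periodic gauge `u`, trivial at the corners `2^{k+1}•z`, and a
# SKEW periodic relative field `X₀` with `U′^{u} = U_s·e^{X₀}` (`gaugeAct u U′ = vary U_s X₀ 1`) and `‖X₀‖ ≤ 2·10³⁴·M·η` on every bond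

Cell `pub-balaban`, sub-cell t4, lineage `b2b-balaban-t4-ne7-p1` (CRUX PROVER NE7 #1 = OWNER of row NE7), gen 94; memo `t4/b2b-balaban-t4-ne7-p1-g94/PAIR-REP-ROAD.md` §3.
Corollary of F323b `NE7PairResidualSupRep.pair_residual_sup_rep` by principal logarithms: `X₀(b) := log(U_s(b)⁻¹U′^{u}(b))` (the series `MatrixLog.mlog`), skew because
the argument is unitary and `1∕4`-close to `1` ([B7] (22)–(23), `B7Prop2Explicit.star_mlog_eq_neg`), `‖X₀‖ ≤ 2‖U_s⁻¹U′^{u} − 1‖` ((26), `MatrixLog.norm_mlog_le_two_mul`),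
`e^{X₀} = U_s⁻¹U′^{u}` (`MatrixLog.exp_mlog`).  The stronger line `10³⁵·card n·M²η ≤ 1` makes `10³⁴Mη ≤ 1∕4`.  In the dictionary of `NE3DecomposedRepOfLinearNormalPart.
ResidualSliceRepT 2 N (k+1) U_s U′ u X₀ Nn α₀`: the members `gauge`, `cornerTrivial` (`(2:ℤ)^{k+1} • z`), `rep`, `skew`, `per`, `hα₀`, `sup` are supplied with
`α₀ = 2·10³⁴·2^{k+1}·η`, i.e. `α₀·M ≤ 2·10³⁴·(M²η)` k-FREE; the member `tangent` (the slice condition) is NOT.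
WHAT ([folklore]; 0 def, 0 sorry): `pair_residual_sup_rep_log`.
HONEST FRAMING: bookkeeping over F323b; nothing of Bałaban's asserted; hleaves NOT discharged; NE7 NOT PROVED; spine 0∕9; finite T⁴ rung (B)+1 — NOT infinite volume, NOT mass
gap, NOT `BetaPertH`, NOT Clay.  Axioms ⊆ {propext, Classical.choice, Quot.sound}.
-/

set_option autoImplicit false

open scoped BigOperators Matrix Matrix.Norms.L2Operator
open Finset NormedSpace

namespace Summit.QuantumFields.BalabanUV.T4Continuum.NE7PairResidualSupRepLog

open Literature.MathematicalPhysics.QuantumFieldTheory.Balaban1983to89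
open B7Prop1Explicit B7Prop2Explicit MatrixLog
open T4AveragingDeficitWall (IsUnitaryCfg IsSkewDir SmallField vary)
open T4AveragingDeficitWallBoundary (IsPeriodicCfg)
open AveragingDeficitPeriodicCounting (IsPeriodicDir)
open AveragingDeficitMultiLevelPrep (cavgIter)
open NE3EnergyShapes (IsUnitarySite IsPeriodicSite)
open NE7PairResidualSupRep (pair_residual_sup_rep)

noncomputable section

variable {n : Type} [Fintype n] [DecidableEq n] [Nonempty n]

/-- **THE PAIR RESIDUAL SUP-REPRESENTATIVE IN CHART FORM** (see the file header). [folklore] -/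
theorem pair_residual_sup_rep_log {U' Us : Site 4 → Fin 4 → (Matrix n n ℂ)ˣ} (hU' : IsUnitaryCfg U') (hUs : IsUnitaryCfg Us) {k N : ℕ} (hN : 1 ≤ N)
    (hU'P : IsPeriodicCfg U' ((N * 2 ^ (k + 1) : ℕ) : ℤ)) (hUsP : IsPeriodicCfg Us ((N * 2 ^ (k + 1) : ℕ) : ℤ)) {η : ℝ} (hη : 0 < η)
    (hS' : SmallField U' η) (hSs : SmallField Us η) (htop : cavgIter 2 (k + 1) U' = cavgIter 2 (k + 1) Us)
    (hθ : 100000000000000000000000000000000000 * (Fintype.card n : ℝ) * (((2 : ℝ) ^ (k + 1)) ^ 2 * η) ≤ 1) :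
    ∃ (u : Site 4 → (Matrix n n ℂ)ˣ) (X₀ : Site 4 → Fin 4 → Matrix n n ℂ),
      IsUnitarySite u ∧ IsPeriodicSite u ((N * 2 ^ (k + 1) : ℕ) : ℤ) ∧
      (∀ z : Site 4, u (((2 : ℤ) ^ (k + 1)) • z) = 1) ∧
      gaugeAct u U' = vary Us X₀ 1 ∧ IsSkewDir X₀ ∧ IsPeriodicDir X₀ ((N * 2 ^ (k + 1) : ℕ) : ℤ) ∧
      (∀ (x : Site 4) (μ : Fin 4), ‖X₀ x μ‖ ≤ 2 * (10000000000000000000000000000000000 * (2 : ℝ) ^ (k + 1) * η)) := by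
  letI : CStarAlgebra (Matrix n n ℂ) := {}
  have hcard : (1 : ℝ) ≤ Fintype.card n := by exact_mod_cast Fintype.card_pos
  have hM1 : (1 : ℝ) ≤ (2 : ℝ) ^ (k + 1) := one_le_pow₀ (by norm_num)
  have hpos : 0 ≤ ((2 : ℝ) ^ (k + 1)) ^ 2 * η := by positivity
  have hθ' : 1000000000000000000000 * (Fintype.card n : ℝ) * (((2 : ℝ) ^ (k + 1)) ^ 2 * η) ≤ 1 := by
    have : 0 ≤ (Fintype.card n : ℝ) * (((2 : ℝ) ^ (k + 1)) ^ 2 * η) := by positivity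
    nlinarith
  -- the bound `10³⁴·M·η ≤ 1/4`
  have hr : 10000000000000000000000000000000000 * (2 : ℝ) ^ (k + 1) * η ≤ 1 / 4 := by
    have h1 : (2 : ℝ) ^ (k + 1) * η ≤ ((2 : ℝ) ^ (k + 1)) ^ 2 * η := by nlinarith [hη.le]
    have h2 : ((2 : ℝ) ^ (k + 1)) ^ 2 * η ≤ (Fintype.card n : ℝ) * (((2 : ℝ) ^ (k + 1)) ^ 2 * η) := le_mul_of_one_le_left hpos hcard
    nlinarith
  obtain ⟨u, huU, huP, hupin, huerr⟩ := pair_residual_sup_rep hU' hUs hN hU'P hUsP hη hS' hSs htop hθ'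
  set r : ℝ := 10000000000000000000000000000000000 * (2 : ℝ) ^ (k + 1) * η with hrdef
  -- the relative field: principal logarithm of the pair defect
  refine ⟨u, fun x μ => mlog (((Us x μ)⁻¹ * gaugeAct u U' x μ : (Matrix n n ℂ)ˣ) : Matrix n n ℂ), huU, huP, fun z => ?_, ?_, fun x μ => ?_,
    fun x κ μ => ?_, fun x μ => ?_⟩
  · have : ((2 : ℤ) ^ (k + 1)) • z = (((2 ^ (k + 1) : ℕ) : ℤ)) • z := by push_cast; rfl
    rw [this]; exact hupin z
  · -- `U′^{u} = U_s · e^{X₀}`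
    funext x μ
    have hY1 : ‖(((Us x μ)⁻¹ : (Matrix n n ℂ)ˣ) : Matrix n n ℂ) * ((gaugeAct u U' x μ : (Matrix n n ℂ)ˣ) : Matrix n n ℂ) - 1‖ < 1 := by
      rw [← Units.val_mul]; linarith [huerr x μ]
    apply Units.ext
    simp only [vary, Units.val_mul, val_expUnit, Complex.ofReal_one, one_smul]
    rw [exp_mlog hY1, ← mul_assoc, Units.mul_inv, one_mul]
  · -- skewness ((22)–(23))
    have hYu : (((Us x μ)⁻¹ * gaugeAct u U' x μ : (Matrix n n ℂ)ˣ) : Matrix n n ℂ) ∈ unitary (Matrix n n ℂ) := by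
      have h : (Us x μ)⁻¹ * gaugeAct u U' x μ ∈ unitaryUnits (Matrix n n ℂ) :=
        (unitaryUnits _).mul_mem ((unitaryUnits _).inv_mem (hUs x μ))
          ((unitaryUnits _).mul_mem ((unitaryUnits _).mul_mem (huU x) (hU' x μ)) ((unitaryUnits _).inv_mem (huU _)))
      exact mem_unitaryUnits.mp h
    exact skewAdjoint.mem_iff.mpr (star_mlog_eq_neg hYu ((huerr x μ).trans hr))
  · -- periodicity
    show mlog (((Us (x + ((N * 2 ^ (k + 1) : ℕ) : ℤ) • e κ) μ)⁻¹ * gaugeAct u U' (x + ((N * 2 ^ (k + 1) : ℕ) : ℤ) • e κ) μ : (Matrix n n ℂ)ˣ) : Matrix n n ℂ)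
      = mlog (((Us x μ)⁻¹ * gaugeAct u U' x μ : (Matrix n n ℂ)ˣ) : Matrix n n ℂ)
    have hg : gaugeAct u U' (x + ((N * 2 ^ (k + 1) : ℕ) : ℤ) • e κ) μ = gaugeAct u U' x μ := by
      simp only [gaugeAct]
      rw [add_right_comm x _ (e μ), huP x κ, huP (x + e μ) κ, hU'P x κ μ]
    rw [hg, hUsP]
  · -- the sup bound ((26))
    exact (norm_mlog_le_two_mul ((huerr x μ).trans (hr.trans (by norm_num)))).trans (by linarith [huerr x μ])

end

end Summit.QuantumFields.BalabanUV.T4Continuum.NE7PairResidualSupRepLog
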